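import Mathlib
import Summits.KontsevichZagierPeriods.Zeta5Search.Elimination.SecondShell
import HarnessLib

/-!
# ζ(5) search — class `elim`: THE WHOLE UP-CONE — every partner `b + e_{i₁+1} + ⋯ + e_{iₛ+1}` expands in the diagonal
# frame `v(b), v(b⁺), v(b⁺⁺), …` by ONE recursion over (DS), and every pair of up-cone partners eliminates `ζ(3)` INTO
# THE ℚ-SPAN OF BROWN–ZUDILIN'S OWN ELIMINANTS ALONG THE DIAGONAL (cell `pub-zeta5`, fam-elim, E-L15; capstone of E-L10/12/13)

HONEST FRAMING: systematic search; no irrationality claim unless certified.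

OUR work (Summit side; `families/elim/FAMILY.md` §17.12).  Notation as in E-L10/E-L12/E-L13: `v(x) = (U, W, V)(x) ∈ ℚ³`
is the coefficient vector of the dual Brown–Zudilin form `F̃₇(x) = U(x)ζ(5) + W(x)ζ(3) − V(x)` (`vwp_decomposition`),
`up x i = x + e_{i+1}` (slot `i < 7`), `x⁺ = dsShift x`, `x^{(m)} = dsShift^[m] x`, `λ_i(x) = dsLam x i`; (DS) is the D2
lane's relation `X(x⁺) = X(x + e_{i+1}) − λ_i(x)·X(x)` (`dictionary_dsShift`, `typeI_dsShift`, `vwpDual_dsShift`).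
E-L10 treated the first shell, E-L12 the diagonal partner, E-L13 the second shell and `b⁺⁺` — shell by shell.  This file
does the whole UP-CONE `{b + e : e ∈ ℕ⁷}` (within the room (DS) needs) by ONE induction on the path, at the level of IDENTITIES:
* `upList b p` — the partner reached along the slot list `p`; `flagCoeff b p k` — its FLAG COEFFICIENTS `c_k(b; p) ∈ ℤ`,
  `c_k(b; i :: r) = c_{k−1}(b⁺; r) + λ_i(upList b r)·c_k(b; r)`, unitriangular (`flagCoeff_length`, `flagCoeff_eq_zero`);
  for `|p| ≤ 2` they are E-L12's `(λ_i, 1)` and E-L13's `(B_{ij}, A_{ij}, 1)` (`flagCoeff_single`, `flagCoeff_pair`);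
* `flag_expansion` — for every shape function satisfying (DS) (`SatisfiesDS`; `v`, `W`, `F̃₇` do: `satisfiesDS_*`) and
  every path with room (`PathAdm`): `X(upList b p) = Σ_{k ≤ |p|} c_k(b; p) • X(b^{(k)})` (`typeI_upList`, `vwpDual_upList`,
  …) — the whole up-cone of coefficient vectors, and the form, lie in the DIAGONAL FLAG `⟨X(b), X(b⁺), …⟩`;
* `wedge_expand`, `pairElim_upList` — the `ζ(3)`-eliminant (likewise its `ζ(5)`-coefficient and constant term) of ANY two
  up-cone partners is the double sum `Σ_{k,l} c_k(b;p) c_l(b;q) · E(b^{(k)}, b^{(l)})` of DIAGONAL pair eliminants, `E = pairElim`;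
* `pairElim_cyclic` — the exchange identity `W(x)E(y,z) + W(y)E(z,x) + W(z)E(x,y) = 0` for ANY three shapes, whence
  `pairElim_iterate_mem_diagSpan`: every `E(b^{(k)}, b^{(l)})` lies in the `ℚ`-span `diagSpan b N` of the CONSECUTIVE
  eliminants `diagElim b^{(m)} = E(b^{(m)}, b^{(m+1)})`, `m < N`, once the pivots `W(b^{(m)})`, `0 < m < N`, are non-zero;
* `upCone_elim_mem_diagSpan`, `upCone_elim_mem_partnerSpan` — **conclusion**: for all paths `p, q` with room at `b` and
  non-vanishing pivots, `W(b″)F̃₇(b′) − W(b′)F̃₇(b″) ∈ Σ_{m < max(|p|,|q|)} ℚ · diagElim (b^{(m)})` for `b′ = upList b p`,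
  `b″ = upList b q`, and each `diagElim (b^{(m)})` IS Brown–Zudilin's `partnerElim (b^{(m)}) i = Q(b^{(m)})ζ(5) − P(b^{(m)})` (E-L12).

Reading for the class (T4, structural; FAMILY.md §10 (u)): no pair of partners anywhere in the up-cone of the Brown–Zudilin
module yields a `ζ(3)`-free form outside the `ℚ`-span of Brown–Zudilin's own two-term forms at the diagonal points below the
longer path — the exact, all-shell form of gen-1's 'partner choice immaterial' atlas (§3.5–§3.7) and of THEOREM P1/P2′.
What this is NOT: anything about sizes, denominators, valuations or irrationality; the pivots `W(b^{(m)}) ≠ 0` are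
HYPOTHESES (census territory); down-shifts and odd shifts of `b₀` alone are outside the cone (no (DS) there); the flag
coefficients are given by their recursion — path-independence is neither needed nor claimed.
-/


noncomputable section

open Finset

namespace Summit.KontsevichZagierPeriods.Zeta5Search.Elimination

open Summit.KontsevichZagierPeriods.Zeta5Search.DualSeries (InBox)
open Summit.KontsevichZagierPeriods.Zeta5Search.WedgeDictionary
open Literature.NumberTheory.Irrationality.BrownZudilin2022 (vwpDual)

/-- The up-cone partner `b + e_{i₁+1} + ⋯ + e_{iₛ+1}` reached along the slot list `p = [i₁, …, iₛ]` (the LAST entry is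
applied first: `upList b (i :: r) = up (upList b r) i`). -/
def upList (b : ℕ → ℤ) : List ℕ → (ℕ → ℤ)
  | [] => b
  | i :: r => up (upList b r) i

/-- `upList b [] = b`. -/
@[simp] theorem upList_nil (b : ℕ → ℤ) : upList b [] = b := rfl

/-- `upList b (i :: r) = (upList b r) + e_{i+1}`. -/
@[simp] theorem upList_cons (b : ℕ → ℤ) (i : ℕ) (r : List ℕ) : upList b (i :: r) = up (upList b r) i := rfl

/-- The leading entry is untouched along the cone: `(upList b p)₀ = b₀`. -/
theorem upList_zero (b : ℕ → ℤ) (p : List ℕ) : upList b p 0 = b 0 := by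
  induction p with
  | nil => rfl
  | cons i r ih => rw [upList_cons, up_zero, ih]

/-- Slot `j+1` is raised once per occurrence of `j` in the path: `(upList b p)_{j+1} = b_{j+1} + #{j ∈ p}`. -/
theorem upList_succ (b : ℕ → ℤ) (p : List ℕ) (j : ℕ) :
    upList b p (j + 1) = b (j + 1) + (p.count j : ℤ) := by
  induction p with
  | nil => simp
  | cons i r ih =>
    rw [upList_cons]
    by_cases h : i = j
    · subst h; rw [up_self, ih, List.count_cons_self]; push_cast; ring
    · rw [up_of_ne (Ne.symm h), ih, List.count_cons_of_ne h]

/-- The diagonal shift commutes with every up-cone path: `(upList b p)⁺ = upList b⁺ p`. -/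
theorem dsShift_upList (b : ℕ → ℤ) (p : List ℕ) : dsShift (upList b p) = upList (dsShift b) p := by
  induction p with
  | nil => rfl
  | cons i r ih => rw [upList_cons, upList_cons, dsShift_up, ih]

/-- Excess along a path of slots `< 7`: `d(upList b p) = d(b) − |p|`. -/
theorem dOf_upList (b : ℕ → ℤ) (p : List ℕ) (hp : ∀ i ∈ p, i < 7) : dOf (upList b p) = dOf b - p.length := by
  induction p with
  | nil => simp
  | cons i r ih =>
    have hi : i ∈ range 7 := mem_range.2 (hp i (by simp))
    rw [upList_cons, dOf_up _ hi, ih (fun j hj => hp j (by simp [hj]))]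
    simp only [List.length_cons]; push_cast; ring

/-- A path whose visited slots have room keeps the partner in the box. -/
theorem inBox_upList {b : ℕ → ℤ} {p : List ℕ} (hb : InBox b)
    (hroom : ∀ i ∈ p, b (i + 1) + (p.count i : ℤ) ≤ b 0 + 1) : InBox (upList b p) := by
  refine ⟨by rw [upList_zero]; exact hb.1, fun j hj => ?_⟩
  rw [upList_succ, upList_zero]
  obtain ⟨h0, h1⟩ := hb.2 j hj
  by_cases hm : j ∈ p
  · have := hroom j hm; constructor <;> omega
  · rw [List.count_eq_zero_of_not_mem hm]; constructor <;> omega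

/-- ROOM for the path `p` at the base `b`: `b` is in the box, its excess is at least `|p| − 1`, the slots are `< 7`, and
a slot visited `m` times can be raised `m` times (`b_{i+1} + m ≤ b₀ + 1`). -/
def PathAdm (b : ℕ → ℤ) (p : List ℕ) : Prop :=
  InBox b ∧ (p.length : ℤ) ≤ dOf b + 1 ∧ (∀ i ∈ p, i < 7) ∧ ∀ i ∈ p, b (i + 1) + (p.count i : ℤ) ≤ b 0 + 1

/-- Room is inherited by the tail of the path, at `b` and at `b⁺`, and delivers the four hypotheses of (DS) at the point
`upList b r` and the slot `i`. -/
theorem PathAdm.cons {b : ℕ → ℤ} {i : ℕ} {r : List ℕ} (h : PathAdm b (i :: r)) :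
    PathAdm b r ∧ PathAdm (dsShift b) r ∧
      (InBox (upList b r) ∧ 0 ≤ dOf (upList b r) ∧ i ∈ range 7 ∧ upList b r (i + 1) ≤ upList b r 0) := by
  obtain ⟨hb, hlen, hsl, hroom⟩ := h
  simp only [List.length_cons, Nat.cast_add, Nat.cast_one] at hlen
  have hslr : ∀ j ∈ r, j < 7 := fun j hj => hsl j (by simp [hj])
  have hroomr : ∀ j ∈ r, b (j + 1) + (r.count j : ℤ) ≤ b 0 + 1 := fun j hj => by
    have h1 := hroom j (by simp [hj])
    have h2 : (r.count j : ℤ) ≤ ((i :: r).count j : ℤ) := by exact_mod_cast (List.sublist_cons_self i r).count_le j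
    omega
  have hi0 : b (i + 1) + (r.count i : ℤ) ≤ b 0 := by
    have h1 := hroom i (by simp)
    rw [List.count_cons_self] at h1; push_cast at h1; omega
  refine ⟨⟨hb, by omega, hslr, hroomr⟩, ⟨inBox_dsShift hb, by rw [dOf_dsShift]; omega, hslr, fun j hj => ?_⟩,
    inBox_upList hb hroomr, by rw [dOf_upList b r hslr]; omega, mem_range.2 (hsl i (by simp)), ?_⟩
  · have := hroomr j hj; rw [dsShift_succ, dsShift_zero]; omega
  · rw [upList_succ, upList_zero]; omega

/-- The FLAG COEFFICIENTS `c_k(b; p)` of the up-cone partner `upList b p` in the diagonal frame `X(b), X(b⁺), X(b⁺⁺), …`: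
`c(b; []) = (1, 0, 0, …)`, `c_0(b; i :: r) = λ_i(upList b r)·c_0(b; r)`,
`c_{k+1}(b; i :: r) = c_k(b⁺; r) + λ_i(upList b r)·c_{k+1}(b; r)` — one application of (DS) per step. -/
def flagCoeff : (ℕ → ℤ) → List ℕ → ℕ → ℚ
  | _, [], k => if k = 0 then 1 else 0
  | b, i :: r, 0 => dsLam (upList b r) i * flagCoeff b r 0
  | b, i :: r, k + 1 => flagCoeff (dsShift b) r k + dsLam (upList b r) i * flagCoeff b r (k + 1)

/-- `c_k(b; []) = [k = 0]`. -/
@[simp] theorem flagCoeff_nil (b : ℕ → ℤ) (k : ℕ) : flagCoeff b [] k = if k = 0 then 1 else 0 := by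
  cases k <;> simp [flagCoeff]

/-- `c_0(b; i :: r) = λ_i(upList b r)·c_0(b; r)`. -/
@[simp] theorem flagCoeff_cons_zero (b : ℕ → ℤ) (i : ℕ) (r : List ℕ) :
    flagCoeff b (i :: r) 0 = dsLam (upList b r) i * flagCoeff b r 0 := by
  simp [flagCoeff]

/-- `c_{k+1}(b; i :: r) = c_k(b⁺; r) + λ_i(upList b r)·c_{k+1}(b; r)`. -/
@[simp] theorem flagCoeff_cons_succ (b : ℕ → ℤ) (i : ℕ) (r : List ℕ) (k : ℕ) :
    flagCoeff b (i :: r) (k + 1) = flagCoeff (dsShift b) r k + dsLam (upList b r) i * flagCoeff b r (k + 1) := by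
  simp [flagCoeff]

/-- Above the top the flag coefficients vanish: `c_k(b; p) = 0` for `k > |p|`. -/
theorem flagCoeff_eq_zero {b : ℕ → ℤ} {p : List ℕ} {k : ℕ} (hk : p.length < k) : flagCoeff b p k = 0 := by
  induction p generalizing b k with
  | nil => cases k with | zero => simp at hk | succ k => simp
  | cons i r ih =>
    cases k with
    | zero => simp at hk
    | succ k =>
      simp only [List.length_cons] at hk
      rw [flagCoeff_cons_succ, ih (by omega), ih (by omega)]
      ring

/-- The change of frame is UNITRIANGULAR: the top coefficient is `c_{|p|}(b; p) = 1`. -/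
theorem flagCoeff_length (b : ℕ → ℤ) (p : List ℕ) : flagCoeff b p p.length = 1 := by
  induction p generalizing b with
  | nil => simp
  | cons i r ih =>
    simp only [List.length_cons]
    rw [flagCoeff_cons_succ, ih, flagCoeff_eq_zero (by simp)]
    ring

/-- Consistency with E-L12: along the one-step path `[i]`, `c(b; [i]) = (λ_i(b), 1)`
(`v(b + e_{i+1}) = v(b⁺) + λ_i(b)·v(b)`, (DS) rearranged). -/
theorem flagCoeff_single (b : ℕ → ℤ) (i : ℕ) : flagCoeff b [i] 0 = dsLam b i ∧ flagCoeff b [i] 1 = 1 := by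
  simp

/-- Consistency with E-L13: along the two-step path `[i, j]`, `c(b; [i, j]) = (B_{ij}(b), A_{ij}(b), 1)`
(`typeI_up_up`: `v(b + e_{i+1} + e_{j+1}) = v(b⁺⁺) + A_{ij}·v(b⁺) + B_{ij}·v(b)`). -/
theorem flagCoeff_pair (b : ℕ → ℤ) (i j : ℕ) :
    flagCoeff b [i, j] 0 = secB b i j ∧ flagCoeff b [i, j] 1 = secA b i j ∧ flagCoeff b [i, j] 2 = 1 := by
  refine ⟨?_, ?_, ?_⟩ <;> simp [secA, secB]

section Expansion

variable {M : Type*} [AddCommGroup M] [Module ℚ M]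

/-- A shape function `X` (with values in a `ℚ`-module) SATISFIES (DS) if `X(c⁺) = X(c + e_{i+1}) − λ_i(c) • X(c)` whenever
(DS) is available: `c` in the box, `d(c) ≥ 0`, `i < 7`, `c_{i+1} ≤ c₀`. -/
def SatisfiesDS (X : (ℕ → ℤ) → M) : Prop :=
  ∀ (c : ℕ → ℤ) (i : ℕ), InBox c → 0 ≤ dOf c → i ∈ range 7 → c (i + 1) ≤ c 0 →
    X (dsShift c) = X (up c i) - dsLam c i • X c

/-- **THE UP-CONE IN THE DIAGONAL FRAME.** For every shape function satisfying (DS) and every path with room,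
`X(upList b p) = Σ_{k ≤ |p|} c_k(b; p) • X(b^{(k)})`, `b^{(k)} = dsShift^[k] b`. -/
theorem flag_expansion {X : (ℕ → ℤ) → M} (hX : SatisfiesDS X) (p : List ℕ) :
    ∀ b : ℕ → ℤ, PathAdm b p →
      X (upList b p) = ∑ k ∈ range (p.length + 1), flagCoeff b p k • X (dsShift^[k] b) := by
  induction p with
  | nil => intro b _; simp
  | cons i r ih =>
    intro b hp
    obtain ⟨hpt, hpd, hbr, hdr, hi, hli⟩ := hp.cons
    have h1 := hX (upList b r) i hbr hdr hi hli
    rw [dsShift_upList] at h1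
    have h2 : X (up (upList b r) i) = X (upList (dsShift b) r) + dsLam (upList b r) i • X (upList b r) := by
      rw [h1]; abel
    have IH0 := ih b hpt
    have IH1 := ih (dsShift b) hpd
    set L := dsLam (upList b r) i with hL
    rw [upList_cons, h2, IH1, IH0, Finset.smul_sum]
    simp only [List.length_cons]
    rw [Finset.sum_range_succ' (fun k => flagCoeff b (i :: r) k • X (dsShift^[k] b))]
    simp only [flagCoeff_cons_succ, flagCoeff_cons_zero, add_smul, Finset.sum_add_distrib, Function.iterate_succ_apply,
      Function.iterate_zero, id]
    have htop : ∑ k ∈ range (r.length + 1), (L * flagCoeff b r (k + 1)) • X (dsShift^[k] (dsShift b)) +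
        (L * flagCoeff b r 0) • X b = ∑ k ∈ range (r.length + 1), L • flagCoeff b r k • X (dsShift^[k] b) := by
      have e := Finset.sum_range_succ' (fun k => (L * flagCoeff b r k) • X (dsShift^[k] b)) (r.length + 1)
      simp only [Function.iterate_succ_apply, Function.iterate_zero, id] at e
      rw [← e, Finset.sum_range_succ, flagCoeff_eq_zero (lt_add_one _), mul_zero, zero_smul, add_zero]
      refine Finset.sum_congr rfl fun k _ => ?_
      rw [smul_smul]
    rw [← htop]
    simp only [mul_smul]
    abel

/-- `v = (U, W, V)` satisfies (DS) (`typeI_dsShift`, E-L12). -/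
theorem satisfiesDS_typeI : SatisfiesDS typeI := fun c _ hb hd hi hli => typeI_dsShift c hb hd hi hli

/-- `W` satisfies (DS) (`dictionary_dsShift`). -/
theorem satisfiesDS_coeffW : SatisfiesDS coeffW := fun c _ hb hd hi hli => by
  simpa [up, smul_eq_mul] using (dictionary_dsShift c hb hd hi hli).2.1

/-- The form `F̃₇ = vwpDual 7` satisfies (DS) (`vwpDual_dsShift`, E-L12; `ℝ` as a `ℚ`-module). -/
theorem satisfiesDS_vwpDual : SatisfiesDS (fun c => vwpDual 7 c) := fun c _ hb hd hi hli => by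
  simpa [Rat.smul_def] using vwpDual_dsShift c hb hd hi hli

end Expansion

/-- **The whole up-cone of coefficient vectors lies in the diagonal flag:**
`v(upList b p) = Σ_{k ≤ |p|} c_k(b; p) • v(b^{(k)})`. -/
theorem typeI_upList {b : ℕ → ℤ} {p : List ℕ} (hp : PathAdm b p) :
    typeI (upList b p) = ∑ k ∈ range (p.length + 1), flagCoeff b p k • typeI (dsShift^[k] b) :=
  flag_expansion satisfiesDS_typeI p b hp

/-- `W(upList b p) = Σ_k c_k(b; p)·W(b^{(k)})`. -/
theorem coeffW_upList {b : ℕ → ℤ} {p : List ℕ} (hp : PathAdm b p) :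
    coeffW (upList b p) = ∑ k ∈ range (p.length + 1), flagCoeff b p k * coeffW (dsShift^[k] b) := by
  simpa [smul_eq_mul] using flag_expansion satisfiesDS_coeffW p b hp

/-- **The form along the up-cone:** `F̃₇(upList b p) = Σ_k c_k(b; p)·F̃₇(b^{(k)})`. -/
theorem vwpDual_upList {b : ℕ → ℤ} {p : List ℕ} (hp : PathAdm b p) :
    vwpDual 7 (upList b p) = ∑ k ∈ range (p.length + 1), (flagCoeff b p k : ℝ) * vwpDual 7 (dsShift^[k] b) := by
  simpa [Rat.smul_def] using flag_expansion satisfiesDS_vwpDual p b hp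

/-- Generic exchange identity behind every `2 × 2` elimination of two expanded partners (pure commutative algebra):
`(Σ_l d_l W_l)(Σ_k c_k F_k) − (Σ_k c_k W_k)(Σ_l d_l F_l) = Σ_k Σ_l c_k d_l (W_l F_k − W_k F_l)`. -/
theorem wedge_expand {R : Type*} [CommRing R] (s t : ℕ) (c d W F : ℕ → R) :
    (∑ l ∈ range t, d l * W l) * (∑ k ∈ range s, c k * F k) - (∑ k ∈ range s, c k * W k) * (∑ l ∈ range t, d l * F l) =
      ∑ k ∈ range s, ∑ l ∈ range t, c k * d l * (W l * F k - W k * F l) := by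
  have h1 : (∑ l ∈ range t, d l * W l) * (∑ k ∈ range s, c k * F k) =
      ∑ k ∈ range s, ∑ l ∈ range t, c k * d l * (W l * F k) := by
    rw [Finset.sum_mul_sum, Finset.sum_comm]
    exact Finset.sum_congr rfl fun k _ => Finset.sum_congr rfl fun l _ => by ring
  have h2 : (∑ k ∈ range s, c k * W k) * (∑ l ∈ range t, d l * F l) =
      ∑ k ∈ range s, ∑ l ∈ range t, c k * d l * (W k * F l) := by
    rw [Finset.sum_mul_sum]
    exact Finset.sum_congr rfl fun k _ => Finset.sum_congr rfl fun l _ => by ring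
  rw [h1, h2, ← Finset.sum_sub_distrib]
  refine Finset.sum_congr rfl fun k _ => ?_
  rw [← Finset.sum_sub_distrib]
  exact Finset.sum_congr rfl fun l _ => by ring

/-- **Every up-cone pair eliminant is a double sum of DIAGONAL pair eliminants** weighted by flag coefficients:
`E(upList b p, upList b q) = Σ_{k ≤ |p|} Σ_{l ≤ |q|} c_k(b;p) c_l(b;q) · E(b^{(k)}, b^{(l)})`, `E = pairElim`. -/
theorem pairElim_upList {b : ℕ → ℤ} {p q : List ℕ} (hp : PathAdm b p) (hq : PathAdm b q) :
    pairElim (upList b p) (upList b q) =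
      ∑ k ∈ range (p.length + 1), ∑ l ∈ range (q.length + 1),
        ((flagCoeff b p k * flagCoeff b q l : ℚ) : ℝ) * pairElim (dsShift^[k] b) (dsShift^[l] b) := by
  unfold pairElim
  rw [coeffW_upList hq, vwpDual_upList hp, coeffW_upList hp, vwpDual_upList hq]
  push_cast
  rw [wedge_expand]

/-- `E(x, x) = 0`. -/
theorem pairElim_self (x : ℕ → ℤ) : pairElim x x = 0 := by unfold pairElim; ring

/-- `E(x, y) = −E(y, x)`. -/
theorem pairElim_swap (x y : ℕ → ℤ) : pairElim x y = -pairElim y x := by unfold pairElim; ring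

/-- **Cyclic exchange (Plücker) identity for ANY three shapes** (no hypotheses):
`W(x)·E(y, z) + W(y)·E(z, x) + W(z)·E(x, y) = 0`. -/
theorem pairElim_cyclic (x y z : ℕ → ℤ) :
    (coeffW x : ℝ) * pairElim y z + (coeffW y : ℝ) * pairElim z x + (coeffW z : ℝ) * pairElim x y = 0 := by
  unfold pairElim; ring

/-- The `ℚ`-SPAN (inside `ℝ`) of the first `N` consecutive diagonal eliminants `diagElim (b^{(m)}) = E(b^{(m)}, b^{(m+1)})`,
`m < N` — by E-L12 these are Brown–Zudilin's eliminants `Q(b^{(m)})ζ(5) − P(b^{(m)})` along the diagonal. -/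
def diagSpan (b : ℕ → ℤ) (N : ℕ) : Submodule ℚ ℝ :=
  Submodule.span ℚ ((fun m => diagElim (dsShift^[m] b)) '' (range N : Finset ℕ))

/-- The generators belong to the span. -/
theorem diagElim_mem_diagSpan (b : ℕ → ℤ) {m N : ℕ} (hm : m < N) : diagElim (dsShift^[m] b) ∈ diagSpan b N :=
  Submodule.subset_span ⟨m, by simpa using hm, rfl⟩

/-- The spans increase with `N`. -/
theorem diagSpan_mono (b : ℕ → ℤ) {N N' : ℕ} (h : N ≤ N') : diagSpan b N ≤ diagSpan b N' :=
  Submodule.span_mono (Set.image_mono (by simpa using h))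

/-- Rational multiples (written as real products) stay in the span. -/
theorem ratMul_mem_diagSpan (b : ℕ → ℤ) {N : ℕ} (q : ℚ) {x : ℝ} (hx : x ∈ diagSpan b N) :
    (q : ℝ) * x ∈ diagSpan b N := by
  rw [← Rat.smul_def]; exact Submodule.smul_mem _ q hx

/-- **Every diagonal pair reduces to consecutive ones.** If the pivots `W(b^{(m)})`, `0 < m < l`, are non-zero then
`E(b, b^{(l)}) ∈ ⟨diagElim b, …, diagElim b^{(l−1)}⟩_ℚ` — by the exchange identity
`W(b^{(l+1)})·E(b, b^{(l+2)}) = W(b^{(l+2)})·E(b, b^{(l+1)}) + W(b)·E(b^{(l+1)}, b^{(l+2)})` (E-L13's `plucker_pairElim` is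
`l = 0`). -/
theorem pairElim_iterate_mem_diagSpan (b : ℕ → ℤ) (l : ℕ)
    (hW : ∀ m, 0 < m → m < l → coeffW (dsShift^[m] b) ≠ 0) : pairElim b (dsShift^[l] b) ∈ diagSpan b l := by
  induction l with
  | zero => simp [pairElim_self]
  | succ l ih =>
    cases l with
    | zero => exact diagElim_mem_diagSpan b (m := 0) zero_lt_one
    | succ l =>
      have hWl : (coeffW (dsShift^[l + 1] b) : ℝ) ≠ 0 := by exact_mod_cast hW (l + 1) (by omega) (by omega)
      have hcyc := pairElim_cyclic (dsShift^[l + 1] b) b (dsShift^[l + 2] b)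
      have key : pairElim b (dsShift^[l + 2] b) =
          ((coeffW (dsShift^[l + 2] b) / coeffW (dsShift^[l + 1] b) : ℚ) : ℝ) * pairElim b (dsShift^[l + 1] b) +
            ((coeffW b / coeffW (dsShift^[l + 1] b) : ℚ) : ℝ) * diagElim (dsShift^[l + 1] b) := by
        have hd : diagElim (dsShift^[l + 1] b) = pairElim (dsShift^[l + 1] b) (dsShift^[l + 2] b) := by
          rw [(diag_eq_pair _).2.2.2, ← Function.iterate_succ_apply' dsShift (l + 1) b]
        rw [pairElim_swap (dsShift^[l + 2] b) (dsShift^[l + 1] b)] at hcyc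
        rw [hd]
        push_cast
        field_simp
        rw [pairElim_swap b (dsShift^[l + 1] b)]
        linear_combination hcyc
      rw [key]
      refine Submodule.add_mem _ (ratMul_mem_diagSpan b _ (diagSpan_mono b (by omega) (ih fun m hm hml => ?_)))
        (ratMul_mem_diagSpan b _ (diagElim_mem_diagSpan b (by omega)))
      exact hW m hm (by omega)

/-- Every diagonal pair `E(b^{(k)}, b^{(l)})` with `k, l ≤ N` lies in `⟨diagElim b^{(m)} : m < N⟩_ℚ` (given the pivots). -/
theorem pairElim_iterate_iterate_mem_diagSpan (b : ℕ → ℤ) {k l N : ℕ} (hk : k ≤ N) (hl : l ≤ N)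
    (hW : ∀ m, 0 < m → m < N → coeffW (dsShift^[m] b) ≠ 0) :
    pairElim (dsShift^[k] b) (dsShift^[l] b) ∈ diagSpan b N := by
  -- reduce to `k ≤ l` by antisymmetry
  wlog hkl : k ≤ l generalizing k l
  · rw [pairElim_swap, ← neg_one_mul, show (-1 : ℝ) = ((-1 : ℚ) : ℝ) by norm_num]
    exact ratMul_mem_diagSpan b _ (this hl hk (by omega))
  obtain ⟨j, rfl⟩ := Nat.exists_eq_add_of_le hkl
  -- the pair `(b^{(k)}, b^{(k+j)})` is the stride-`j` pair at the base `b^{(k)}`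
  have h1 : pairElim (dsShift^[k] b) (dsShift^[k + j] b) ∈ diagSpan (dsShift^[k] b) j := by
    rw [show dsShift^[k + j] b = dsShift^[j] (dsShift^[k] b) by rw [add_comm, Function.iterate_add_apply]]
    refine pairElim_iterate_mem_diagSpan _ j fun m hm hmj => ?_
    rw [← Function.iterate_add_apply]
    exact hW (m + k) (by omega) (by omega)
  -- and the span at the base `b^{(k)}` sits inside the span at `b`
  have h2 : diagSpan (dsShift^[k] b) j ≤ diagSpan b N := by
    refine Submodule.span_le.2 ?_
    rintro _ ⟨m, hm, rfl⟩
    have hm' : m < j := by simpa using hm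
    simp only [← Function.iterate_add_apply]
    exact diagElim_mem_diagSpan b (by omega)
  exact h2 h1

/-- **THE WHOLE UP-CONE.** For all paths `p, q` with room at `b` and non-vanishing pivots `W(b^{(m)})`,
`0 < m < N = max(|p|, |q|)`: the `ζ(3)`-eliminant of the pair of up-cone partners `(upList b p, upList b q)` lies in the
`ℚ`-span of the consecutive diagonal eliminants `diagElim b, …, diagElim b^{(N−1)}`. -/
theorem upCone_elim_mem_diagSpan {b : ℕ → ℤ} {p q : List ℕ} (hp : PathAdm b p) (hq : PathAdm b q)
    (hW : ∀ m, 0 < m → m < max p.length q.length → coeffW (dsShift^[m] b) ≠ 0) :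
    pairElim (upList b p) (upList b q) ∈ diagSpan b (max p.length q.length) := by
  rw [pairElim_upList hp hq]
  refine Submodule.sum_mem _ fun k hk => Submodule.sum_mem _ fun l hl => ratMul_mem_diagSpan b _ ?_
  have hk' : k ≤ max p.length q.length := by have := mem_range.1 hk; omega
  have hl' : l ≤ max p.length q.length := by have := mem_range.1 hl; omega
  exact pairElim_iterate_iterate_mem_diagSpan b hk' hl' hW

/-- **… and that span IS the span of Brown–Zudilin's own eliminants** `partnerElim (b^{(m)}) i = Q(b^{(m)})ζ(5) − P(b^{(m)})`
(E-L10 `partnerElim_eq`, E-L12 `diagElim_iterate_eq_partnerElim`), for any admissible slot `i` and `N ≤ d(b) + 1`. -/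
theorem upCone_elim_mem_partnerSpan {b : ℕ → ℤ} {p q : List ℕ} (hp : PathAdm b p) (hq : PathAdm b q)
    (hN : ((max p.length q.length : ℕ) : ℤ) ≤ dOf b + 1) {i : ℕ} (hi : i ∈ range 7) (hli : b (i + 1) ≤ b 0)
    (hW : ∀ m, 0 < m → m < max p.length q.length → coeffW (dsShift^[m] b) ≠ 0) :
    pairElim (upList b p) (upList b q) ∈
      Submodule.span ℚ ((fun m => partnerElim (dsShift^[m] b) i) '' (range (max p.length q.length) : Finset ℕ)) := by
  have h := upCone_elim_mem_diagSpan hp hq hW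
  unfold diagSpan at h
  rwa [Set.image_congr (g := fun m => partnerElim (dsShift^[m] b) i) ?_] at h
  intro m hm
  have hm' : m < max p.length q.length := by simpa using hm
  exact diagElim_iterate_eq_partnerElim b hp.1 m (by omega) hi hli

end Summit.KontsevichZagierPeriods.Zeta5Search.Elimination
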